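import Literature.Probability.RandomPlanarGeometry.SAWStripTMExtend
import HarnessLib

/-!
# The enriched strip transfer matrix: geometry and the ghost step (soundness, part 4)

Topic `Literature/Probability/RandomPlanarGeometry` (soundness of `SAWStripTM.lean`, part 4). The
grid geometry behind the signature automaton (`advance`/`joinH`): the cell swept at cell-time `t`
is `cellOf t = (t % l, t / l + 1)` (rows are shifted by one so that row `0` is the dummy row below
the grid), the frontier cell of column `k` at micro-time `u` is `front u k`, `Processed u` says
which cells have been swept, `Adj` is the adjacency (grid edges; the virtual source is adjacent to
the start cell `(0, r₀ + 1)` only, the virtual sink to the cells of the last column), `mateCell`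
decodes a `Mate`, and `potEdge u` is the grid edge decided at micro-step `u`. The **ghost step**
`gstep u σ S e` updates a strand family in parallel with `step u σ e`, by `merge`s.

## References

* I. Jensen, J. Phys. A 37 (2004) 11521–11529, §2.1.
* D. E. Knuth, TAOCP 4A (2011), §7.1.4.
-/

namespace Literature.Probability.RandomPlanarGeometry.SAW

namespace StripTM

variable (l r0 : ℕ)

/-! ### Geometry -/

/-- Adjacency of the enriched grid: grid edges between cells, the virtual source attached to the
start cell `(0, r₀+1)`, the virtual sink attached to every cell of the last column. [folklore] -/
def Adj : XCell → XCell → Prop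
  | .cell c r, .cell c' r' => (c = c' ∧ (r + 1 = r' ∨ r' + 1 = r)) ∨ (r = r' ∧ (c + 1 = c' ∨ c' + 1 = c))
  | .vsrc, .cell c r => c = 0 ∧ r = r0 + 1
  | .cell c r, .vsrc => c = 0 ∧ r = r0 + 1
  | .vsnk, .cell c _ => c + 1 = l
  | .cell c _, .vsnk => c + 1 = l
  | _, _ => False

/-- `Adj` is symmetric. [folklore] -/
theorem adj_symm : ∀ a b, Adj l r0 a b → Adj l r0 b a := by
  intro a b h
  cases a <;> cases b <;> simp only [Adj] at h ⊢ <;> omega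

/-- The cell swept at cell-time `t`. [folklore] -/
def cellOf (t : ℕ) : XCell := .cell (t % l) (t / l + 1)

/-- The cell below `cellOf t` (a dummy of row `0` during the first row). [folklore] -/
def below (t : ℕ) : XCell := .cell (t % l) (t / l)

/-- The cell left of `cellOf t`. [folklore] -/
def leftOf (t : ℕ) : XCell := .cell (t % l - 1) (t / l + 1)

/-- The frontier cell of column `k` at micro-time `u`. [folklore] -/
def front (u k : ℕ) : XCell :=
  if (u % 2 = 0 ∧ k < u / 2 % l) ∨ (u % 2 = 1 ∧ k ≤ u / 2 % l) then .cell k (u / 2 / l + 1)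
  else .cell k (u / 2 / l)

/-- Cells already swept at micro-time `u` (virtual vertices count as swept). [folklore] -/
def Processed (u : ℕ) : XCell → Prop
  | .cell c r => 1 ≤ r ∧ c < l ∧ 2 * ((r - 1) * l + c) + 1 ≤ u
  | _ => True

/-- The vertex denoted by a `Mate` at micro-time `u`. [folklore] -/
def mateCell (u : ℕ) : Mate → XCell
  | .col k => front l u k
  | .src => .vsrc
  | .snk => .vsnk

/-- The grid edge decided at micro-step `u`. [folklore] -/
def potEdge (u : ℕ) : Sym2 XCell :=
  if u % 2 = 0 then s(below l (u / 2), cellOf l (u / 2)) else s(leftOf l (u / 2), cellOf l (u / 2))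

variable {l r0}

/-- Column of `front`. [folklore] -/
theorem front_eq_cell (u k : ℕ) : ∃ r, front l u k = .cell k r := by
  unfold front; split_ifs; exact ⟨_, rfl⟩; exact ⟨_, rfl⟩

/-- `front` is injective in the column. [folklore] -/
theorem front_inj {u k k' : ℕ} (h : front l u k = front l u k') : k = k' := by
  obtain ⟨r, hr⟩ := front_eq_cell (l := l) u k
  obtain ⟨r', hr'⟩ := front_eq_cell (l := l) u k'
  rw [hr, hr'] at h; cases h; rfl

/-- Division with remainder of a successor. [folklore] -/
theorem divmod_succ (t : ℕ) {l : ℕ} (hl : 0 < l) :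
    (t % l + 1 < l → (t + 1) % l = t % l + 1 ∧ (t + 1) / l = t / l) ∧
    (t % l + 1 = l → (t + 1) % l = 0 ∧ (t + 1) / l = t / l + 1) := by
  have h := Nat.div_add_mod t l
  constructor
  · intro hc
    have e : t + 1 = l * (t / l) + (t % l + 1) := by omega
    constructor
    · rw [e, Nat.mul_add_mod, Nat.mod_eq_of_lt hc]
    · rw [e, Nat.mul_add_div hl, Nat.div_eq_of_lt hc, add_zero]
  · intro hc
    have e : t + 1 = l * (t / l + 1) + 0 := by rw [mul_add, mul_one]; omega
    constructor
    · rw [e, Nat.mul_add_mod]; simp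
    · rw [e, Nat.mul_add_div hl]; simp

/-- At an even micro-time the cell below the current cell is the frontier cell of its column.
[folklore] -/
theorem below_eq_front {u : ℕ} (hu : u % 2 = 0) : below l (u / 2) = front l u (u / 2 % l) := by
  unfold below front
  split_ifs with h
  · exfalso; rcases h with ⟨-, h⟩ | ⟨h, -⟩; exact lt_irrefl _ h; omega
  · rfl

/-- After `advance` the current cell is the frontier cell of its column. [folklore] -/
theorem cellOf_eq_front_succ {u : ℕ} (hu : u % 2 = 0) : cellOf l (u / 2) = front l (u + 1) (u / 2 % l) := by
  unfold cellOf front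
  have h2 : (u + 1) / 2 = u / 2 := by omega
  rw [h2]
  split_ifs with h
  · rfl
  · exfalso; apply h; right; exact ⟨by omega, le_rfl⟩

/-- `advance` moves the frontier only in the current column. [folklore] -/
theorem front_succ_of_ne {u k : ℕ} (hu : u % 2 = 0) (hk : k ≠ u / 2 % l) : front l (u + 1) k = front l u k := by
  unfold front
  have h2 : (u + 1) / 2 = u / 2 := by omega
  rw [h2]
  set c := u / 2 % l
  split_ifs with ha hb hb <;> first | rfl | (exfalso; omega)

/-- `joinH` does not move the frontier. [folklore] -/
theorem front_succ_odd {u k : ℕ} (hu : u % 2 = 1) (hk : k < l) : front l (u + 1) k = front l u k := by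
  unfold front
  have h2 : (u + 1) / 2 = u / 2 + 1 := by omega
  rw [h2]
  have hl : 0 < l := by omega
  obtain ⟨hA, hB⟩ := divmod_succ (u / 2) hl
  set t := u / 2
  set c := t % l with hc
  set q := t / l with hq
  have hcl : c < l := Nat.mod_lt _ hl
  rcases Nat.lt_or_ge (c + 1) l with hlt | hge
  · obtain ⟨e1, e2⟩ := hA hlt
    rw [e1, e2]
    split_ifs with ha hb hb <;> first | rfl | (exfalso; omega)
  · obtain ⟨e1, e2⟩ := hB (by omega)
    rw [e1, e2]
    split_ifs with ha hb hb <;> first | rfl | (exfalso; omega)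

/-- At an odd micro-time the current cell is the frontier cell of its column. [folklore] -/
theorem cellOf_eq_front {u : ℕ} (hu : u % 2 = 1) : cellOf l (u / 2) = front l u (u / 2 % l) := by
  unfold cellOf front; rw [if_pos (Or.inr ⟨hu, le_rfl⟩)]

/-- At an odd micro-time the left neighbour is the frontier cell of its column. [folklore] -/
theorem leftOf_eq_front {u : ℕ} (hu : u % 2 = 1) : leftOf l (u / 2) = front l u (u / 2 % l - 1) := by
  unfold leftOf front; rw [if_pos (Or.inr ⟨hu, Nat.sub_le _ _⟩)]

/-- Frontier cells of columns `≥` the current one, at an even time. [folklore] -/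
theorem front_of_ge {u k : ℕ} (hu : u % 2 = 0) (hk : u / 2 % l ≤ k) : front l u k = .cell k (u / 2 / l) := by
  unfold front; split_ifs with h
  · exfalso; rcases h with ⟨-, h⟩ | ⟨h, -⟩ <;> omega
  · rfl

/-- Frontier cells of columns `<` the current one, at an even time. [folklore] -/
theorem front_of_lt {u k : ℕ} (hu : u % 2 = 0) (hk : k < u / 2 % l) : front l u k = .cell k (u / 2 / l + 1) := by
  unfold front; rw [if_pos (Or.inl ⟨hu, hk⟩)]

/-- Cell-time index and coordinates. [folklore] -/
theorem idx_eq_iff {c r t : ℕ} (hl : 0 < l) (hc : c < l) (hr : 1 ≤ r) :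
    (r - 1) * l + c = t ↔ c = t % l ∧ r = t / l + 1 := by
  constructor
  · rintro rfl
    rw [Nat.mul_comm, Nat.mul_add_mod, Nat.mod_eq_of_lt hc, Nat.mul_add_div hl, Nat.div_eq_of_lt hc]
    omega
  · rintro ⟨rfl, rfl⟩
    have := Nat.div_add_mod t l
    simp only [Nat.add_sub_cancel]
    rw [Nat.mul_comm]; omega

/-- The current cell is not yet processed before its `advance`. [folklore] -/
theorem not_processed_cellOf {u : ℕ} (hu : u % 2 = 0) (hl : 0 < l) : ¬ Processed l u (cellOf l (u / 2)) := by
  unfold cellOf Processed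
  rintro ⟨h1, h2, h3⟩
  have := (idx_eq_iff (t := u / 2) hl h2 h1).2 ⟨rfl, rfl⟩
  rw [this] at h3
  omega

/-- `advance` processes exactly the current cell. [folklore] -/
theorem processed_succ_even {u : ℕ} (hu : u % 2 = 0) (hl : 0 < l) (x : XCell) :
    Processed l (u + 1) x ↔ Processed l u x ∨ x = cellOf l (u / 2) := by
  cases x with
  | vsrc => simp [Processed, cellOf]
  | vsnk => simp [Processed, cellOf]
  | cell c r =>
    simp only [Processed, cellOf, XCell.cell.injEq]
    constructor
    · rintro ⟨h1, h2, h3⟩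
      by_cases h : 2 * ((r - 1) * l + c) + 1 ≤ u
      · exact Or.inl ⟨h1, h2, h⟩
      · right
        exact (idx_eq_iff hl h2 h1).1 (by omega)
    · rintro (⟨h1, h2, h3⟩ | ⟨hc, hr⟩)
      · exact ⟨h1, h2, by omega⟩
      · have h2 : c < l := hc ▸ Nat.mod_lt _ hl
        have h1 : 1 ≤ r := hr ▸ Nat.le_add_left 1 _
        have := (idx_eq_iff (t := u / 2) hl h2 h1).2 ⟨hc, hr⟩
        exact ⟨h1, h2, by omega⟩

/-- `joinH` processes nothing. [folklore] -/
theorem processed_succ_odd {u : ℕ} (hu : u % 2 = 1) (x : XCell) : Processed l (u + 1) x ↔ Processed l u x := by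
  cases x with
  | vsrc => simp [Processed]
  | vsnk => simp [Processed]
  | cell c r => simp only [Processed]; constructor <;> rintro ⟨h1, h2, h3⟩ <;> exact ⟨h1, h2, by omega⟩

/-- Processed cells have row `≥ 1`. [folklore] -/
theorem one_le_of_processed {u c r : ℕ} (h : Processed l u (.cell c r)) : 1 ≤ r := h.1

/-! ### The ghost step -/

variable (l r0)

/-- The ghost `advance`: update the strand family in parallel with `advance`. [cite: Jensen2004SAWLowerBounds, §2.1] -/
def gAdvance (t : ℕ) (σ : State) (S : List (List XCell)) (e : Bool) : List (List XCell) :=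
  let c := t % l
  let v := cellOf l t
  let d := below l t
  let st := isStart l r0 t
  match σ.slots[c]?.getD .inter, e with
  | .inter, true => S
  | .empty, true => merge (merge (S ++ [[d]] ++ [[v]]) d v ++ [[.vsnk]]) d .vsnk
  | .stop _, true =>
      if st then merge (merge (S ++ [[v]]) d v ++ [[.vsrc]]) v .vsrc else merge (S ++ [[v]]) d v
  | .empty, false => if st then merge (S ++ [[v]] ++ [[.vsrc]]) v .vsrc else S
  | .inter, false => if st then merge (S ++ [[v]] ++ [[.vsrc]]) v .vsrc else S
  | .stop _, false =>
      if st then merge (merge (S ++ [[.vsnk]]) d .vsnk ++ [[v]] ++ [[.vsrc]]) v .vsrc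
      else merge (S ++ [[.vsnk]]) d .vsnk

/-- The ghost `joinH`. [cite: Jensen2004SAWLowerBounds, §2.1] -/
def gJoinH (t : ℕ) (σ : State) (S : List (List XCell)) (e : Bool) : List (List XCell) :=
  let c := t % l
  let lf := leftOf l t
  let v := cellOf l t
  if e = false then S
  else
    let S₁ := S ++ (if σ.slots[c - 1]?.getD .inter = .empty then [[lf]] else []) ++
      (if σ.slots[c]?.getD .inter = .empty then [[v]] else [])
    merge S₁ lf v

/-- The ghost micro-step. [cite: Jensen2004SAWLowerBounds, §2.1] -/
def gstep (u : ℕ) (σ : State) (S : List (List XCell)) (e : Bool) : List (List XCell) :=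
  if u % 2 = 0 then gAdvance l r0 (u / 2) σ S e else gJoinH l (u / 2) σ S e

end StripTM

end Literature.Probability.RandomPlanarGeometry.SAW
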